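/-
Copyright: statement-level skeleton of a published paper (lit-balaban cell, Phase-2 proof seat p39 gen 11). No proof claims
beyond what the kernel checks below.
-/
import Literature.MathematicalPhysics.QuantumFieldTheory.Balaban1983to89.B3Pi3ZeroLattice

/-!
# B3 — T. Bałaban, *(Higgs)₂,₃ quantum fields in a finite volume. III. Renormalization*, CMP **88** (1983) 411–445
[Balaban1983Higgs3], p. 441 [PDF 31] (the rescaling display) and p. 442 [PDF 32] (the sentence after (3.30)): **the vector
self-energy coefficients `Π^{(η,j₀)}_{μμ′}`, `Π^{(η,j₀)}_{μμ′ν}` ON THE η-LATTICE, INFINITE-VOLUME READING** — the rescaling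
`η`-lattice ↔ `L^{−j₀}`-lattice PROVED as exact identities for the infinite-lattice kernels, the `η`-lattice propagator
`G^η_{j₀}(0)` on `ηℤ³` (`η = L^{−k}`, `k ≥ j₀`) CONSTRUCTED with its lattice equation, and *"the coefficient at the vertex
[Π_{μμ′ν}] is bounded, and the coefficient at the vertex [Π_{μμ′}] is proportional to (L^{j₀}η)^{−d+2}"* PROVED for it
uniformly in `k`, `j₀` and the window (zero field, `d = 3`)

statement-level skeleton of published theorems with citation tags; proofs where landed; nothing here is a claim about
the Yang–Mills mass gap

PDF held: `paper:balaban1983-higgs-2-3-quantum-fields-finite-volume` (journal page = PDF page + 410); pp. 440–442 [PDF 30–32] read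
on the ×2 renders `run/shared/lean/pub/pub-balaban/b2b-balaban-ref1/pages/1983-cmp88-higgs23-III/1983-cmp88-higgs23-III-p030-x2.png`
… `-p032-x2.png` (never the OCR layer alone).

CITATION HEADER (lean-in-tree rule).  Part of the lit-balaban TYPED SKELETON (HOME `run/shared/lean/pub/lit-balaban/`), PHASE 2,
proof seat p39 (generation 11).  WHAT IS REPRODUCED: row **B3.Eq3.25-3.32** of `HOME/lit-balaban-r15/ROWS-B3.md` (fold owner r15):
the INFINITE-LATTICE twin of this seat's gen-10 torus file `B3Eq330EtaZeroTorus` (there: `G^η_k(0) = Σ_{j<k}G^η_{(j)}` on the torus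
`T_η` via p20's `gpiece`, r15's `Pi2_rescale`/`Pi3_rescale` discharged at the torus instance).  Companions: this seat's gen-9 files
`B3Eq316ResolventZeroLattice` (`GxiL` = `G^ξ_k(0)` on ξℤ³ over p03 g8's `B3GkZeroLattice.GkLat`, `xiOf`, `blockAvg`, `green_GxiL`),
`B3Pi2ZeroLattice` (`Pi2L`, `nonloc`, `exists_Pi2L_GxiL_bound`), `B3Pi3ZeroLattice` (`Pi3L`, `nonloc3`, `exists_Pi3L_GxiL_bound`),
`B3Eq316DifferenceKernelBounds` (`dK2`, `d2K`).

THE PRINTED TEXT (verbatim).  p. 441 [PDF 31]: *"Now let us rescale the functions Π^{(η,j₀)}_{μμ′}, Π^{(η,j₀)}_{μμ′ν} from the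
η-lattice to the L^{−j₀}-lattice. We get Π^{(η,j₀)}_{μμ′}(x) = (L^{j₀}η)^{−d+2}Π^{(L^{−j₀},j₀)}_{μμ′}(y),
Π^{(η,j₀)}_{μμ′ν}(x) = (L^{j₀}η)^{−d+3}Π^{(L^{−j₀},j₀)}_{μμ′ν}(y), y = (L^{j₀}η)^{−1}x. We consider the case d = 3, so −d + 2 = −1,
−d + 3 = 0."*  p. 442 [PDF 32], after (3.30): *"where the coefficient at the vertex [Π_{μμ′ν}] is bounded, and the coefficient at
the vertex [Π_{μμ′}] is proportional to (L^{j₀}η)^{−d+2}, and j₀ is the lowest j-index of the external legs."*  p. 440 [PDF 30]: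
*"If j₀ denotes a smallest j-index of external legs, then we sum with respect to j, j′, j″ from 0 to j₀ and we get the same
expressions but with the propagator G^η_{j₀}(0)."*

WHAT IS TYPED / PROVED, and how (`d = 3`; integer site coordinates `ZSite 3`; a spacing enters the infinite-lattice kernels
`dK2`/`d2K`/`nonloc`/`nonloc3`/`Pi2L`/`Pi3L` only as a parameter, so the `η`-lattice point `x = η·i` and the `L^{−j₀}`-lattice
point `y = (L^{j₀}η)^{−1}x = L^{−j₀}·i` carry the SAME integer label `i` — the rescaling is a change of the spacing parameter
`ξ ↦ η = rξ`, `r = L^{j₀}η`, together with the kernel factor `r^{−d+2} = r^{−1}`).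
* §1 MODEL-FREE RESCALING on `ℤ³` (any kernels, any `r ≠ 0`): `dK2 (rξ) (r⁻¹K) = r⁻²·dK2 ξ K`, `d2K (rξ) (r⁻¹K) = r⁻³·d2K ξ K`,
  `nonloc (rξ) (r⁻¹K₁) (r⁻¹K₂) = r⁻¹·nonloc ξ K₁ K₂`, `nonloc3 (rξ) (r⁻¹K₁)(r⁻¹K₂) = nonloc3 ξ K₁ K₂` (the displacement weight
  `η(i′_ν − i_ν) = r·ξ(i′_ν − i_ν)` supplies the extra power), hence **`Pi2L_rescale`**: `Π^{(rξ)}[r⁻¹K₁,r⁻¹K₂,r⁻¹K₃] =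
  r⁻¹·Π^{(ξ)}[K₁,K₂,K₃]` and **`Pi3L_rescale`**: `Π^{(rξ)}_{··ν}[r⁻¹K₁,r⁻¹K₂] = Π^{(ξ)}_{··ν}[K₁,K₂]` — the printed display with
  `−d + 2 = −1`, `−d + 3 = 0`.
* §2 THE η-LATTICE PROPAGATOR: for `1 ≤ j₀ ≤ k`, `η = L^{−k}` (`xiOf ℓ k`), `ξ = L^{−j₀}`, `r = L^{j₀}η = L^{−(k−j₀)}` (`scale330`),
  **`GetaL ℓ j₀ k a m² := r⁻¹·G^ξ_{j₀}(0)`** (`GxiL ℓ j₀ a m²` rescaled) IS the zero-field propagator of the `j₀`-th step read on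
  the finer lattice `ηℤ³`: **`green_GetaL`** — `(−Δ^η + m²(L^{j₀}η)^{−2} + a_{j₀}(L^{j₀}η)^{−2}P_{j₀})G^η_{j₀}(0)(y,·) = δ^η_y`
  (`P_{j₀}` = the mean over the blocks of `L^{j₀}` sites = side `L^{j₀}η`, `blockAvg ℓ j₀`; `δ^η = η^{−3}1`), i.e. the operator of
  (1.25)/(2.6) with its printed `(L^{j}η)^{−2}` in front of `a_jP_j`, from gen 9's `green_GxiL` by `−Δ^{rξ} = r^{−2}(−Δ^ξ)`.
* §3 THE PRINTED DISPLAY AT THE INSTANCE: **`Pi2L_eta_eq`** `Π^{(η,j₀)}_{μμ′}[G^η,G^η,G^η](i) = (L^{j₀}η)^{−1}·Π^{(ξ,j₀)}_{μμ′}[G^ξ,G^ξ,G^ξ](i)`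
  and **`Pi3L_eta_eq`** `Π^{(η,j₀)}_{μμ′ν}[G^η,G^η](i) = Π^{(ξ,j₀)}_{μμ′ν}[G^ξ,G^ξ](i)`.
* §4 **THE SENTENCE AFTER (3.30) ON THE INFINITE η-LATTICE**: **`abs_Pi2L_eta_le`** — there is `Cst` (from `L` and the window only)
  with `|Π^{(η,j₀)}_{μμ′}(i)| ≤ Cst·(L^{j₀}η)^{−1}·|tr q²|` for all `1 ≤ j₀ ≤ k`, `(a, m²)` in the window, `μ, μ′, i` — *"proportional to
  (L^{j₀}η)^{−d+2}"* with a uniformly bounded factor (`Pi2L_eta_eq_bounded`: `= (L^{j₀}η)^{−1}·B`, `|B| ≤ Cst|tr q²|`), and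
  **`abs_Pi3L_eta_le`** — `|Π^{(η,j₀)}_{μμ′ν}(i)| ≤ Cst·|tr q²|` — *"the coefficient at the vertex [Π_{μμ′ν}] is bounded"*; both from
  gen 9's `exists_Pi2L_GxiL_bound` / `exists_Pi3L_GxiL_bound`; assembled as **`eq330_coefficients_zero_lattice`**.
HONEST SCOPE: zero external field, `d = 3`, all three propagator slots at the scale `j₀` (the printed pictures mix `j₀, j′₀, j″₀`;
same estimates); the p. 440 resummation *"we sum with respect to j, j′, j″ from 0 to j₀ and we get … G^η_{j₀}(0)"* is NOT re-proved
on the infinite lattice (p03's `GkLat` carries no scale decomposition (2.6); the torus twin `B3Eq330EtaZeroTorus.sum_gpiece_eq_smul_G0xi`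
does) — here `G^η_{j₀}(0)` on `ηℤ³` is characterized by its lattice equation `green_GetaL`; the PICTURES of (3.30) are not typed;
constants existential.  Mathlib + the cited tree files only; definitions with bodies and theorems, no named fact, no `sorry`;
standard axioms.  Unit `lit-balaban-p39-g11` (Phase-2 proof seat p39, gen 11), HOME `run/shared/lean/pub/lit-balaban/`, 2026-08-22.
-/

open scoped BigOperators
open Finset

namespace Literature.MathematicalPhysics.QuantumFieldTheory.Balaban1983to89.B3Eq330EtaZeroLattice

open B3Sect3VectorSelfEnergy B3CxiPropagator B3Eq316ResolventZeroLattice B3Eq316DifferenceKernelBounds B3Pi2ZeroLattice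
  B3Pi3ZeroLattice

noncomputable section

/-! ## §1 Model-free rescaling of the infinite-lattice kernels under `ξ ↦ rξ`, `K ↦ r⁻¹K` -/

section Rescale

variable {r : ℝ} (ξ : ℝ) (K K₁ K₂ K₃ : ZSite 3 → ZSite 3 → ℝ)

/-- kernel: `(K∂^*)` rescales by `r^{−2}`: `dK2 (rξ) μ (r⁻¹K) = r⁻²·dK2 ξ μ K`. [cite: Balaban1983Higgs3, (3.29) p.441] -/
theorem dK2_rescale (r : ℝ) (μ : Fin 3) (x y : ZSite 3) :
    dK2 (r * ξ) μ (fun p q => r⁻¹ * K p q) x y = r⁻¹ ^ 2 * dK2 ξ μ K x y := by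
  simp only [dK2, mul_inv]
  ring

/-- kernel: `(∂K∂^*)` rescales by `r^{−3}`: `d2K (rξ) μ′ μ (r⁻¹K) = r⁻³·d2K ξ μ′ μ K`. [cite: Balaban1983Higgs3, (3.29) p.441] -/
theorem d2K_rescale (r : ℝ) (μ' μ : Fin 3) (x y : ZSite 3) :
    d2K (r * ξ) μ' μ (fun p q => r⁻¹ * K p q) x y = r⁻¹ ^ 3 * d2K ξ μ' μ K x y := by
  simp only [d2K, mul_inv, mul_pow]
  ring

/-- kernel: the non-local integrand of (3.26) rescales by `r^{−d+2} = r^{−1}` (`d = 3`):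
`nonloc (rξ) (r⁻¹K₁) (r⁻¹K₂) = r⁻¹·nonloc ξ K₁ K₂`. [cite: Balaban1983Higgs3, (3.29) p.441] -/
theorem nonloc_rescale (hr : r ≠ 0) (μ μ' : Fin 3) (y y' : ZSite 3) :
    nonloc (r * ξ) (fun p q => r⁻¹ * K₁ p q) (fun p q => r⁻¹ * K₂ p q) μ μ' y y' = r⁻¹ * nonloc ξ K₁ K₂ μ μ' y y' := by
  simp only [nonloc, dK2_rescale ξ K₁ r, dK2_rescale ξ K₂ r, d2K_rescale ξ K₂ r, mul_pow]
  field_simp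

/-- kernel: the non-local integrand of `Π_{μμ′ν}` (with the displacement weight) rescales by `r^{−d+3} = 1` (`d = 3`):
`nonloc3 (rξ) (r⁻¹K₁) (r⁻¹K₂) = nonloc3 ξ K₁ K₂`. [cite: Balaban1983Higgs3, (3.29) p.441] -/
theorem nonloc3_rescale (hr : r ≠ 0) (μ μ' ν : Fin 3) (y y' : ZSite 3) :
    nonloc3 (r * ξ) (fun p q => r⁻¹ * K₁ p q) (fun p q => r⁻¹ * K₂ p q) μ μ' ν y y' = nonloc3 ξ K₁ K₂ μ μ' ν y y' := by
  simp only [nonloc3, dK2_rescale ξ K₁ r, dK2_rescale ξ K₂ r, d2K_rescale ξ K₂ r, mul_pow]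
  field_simp

/-- **p. 441 rescaling, first display, model-free on ℤ³** (`d = 3`, `−d + 2 = −1`):
`Π^{(rξ)}_{μμ′}[r⁻¹K₁, r⁻¹K₂, r⁻¹K₃](i) = r⁻¹·Π^{(ξ)}_{μμ′}[K₁,K₂,K₃](i)` for every two-variable kernels and every `r ≠ 0`.
[cite: Balaban1983Higgs3, (3.29) p.441] -/
theorem Pi2L_rescale (hr : r ≠ 0) (τ : ℝ) (μ μ' : Fin 3) (y : ZSite 3) :
    Pi2L (r * ξ) τ (fun p q => r⁻¹ * K₁ p q) (fun p q => r⁻¹ * K₂ p q) (fun p q => r⁻¹ * K₃ p q) μ μ' y =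
      r⁻¹ * Pi2L ξ τ K₁ K₂ K₃ μ μ' y := by
  simp only [Pi2L, nonloc_rescale ξ K₁ K₂ hr, dK2_rescale ξ K₃ r, tsum_mul_left]
  split_ifs
  · field_simp
  · ring

/-- **p. 441 rescaling, second display, model-free on ℤ³** (`d = 3`, `−d + 3 = 0`):
`Π^{(rξ)}_{μμ′ν}[r⁻¹K₁, r⁻¹K₂](i) = Π^{(ξ)}_{μμ′ν}[K₁,K₂](i)`. [cite: Balaban1983Higgs3, (3.29) p.441] -/
theorem Pi3L_rescale (hr : r ≠ 0) (τ : ℝ) (μ μ' ν : Fin 3) (y : ZSite 3) :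
    Pi3L (r * ξ) τ (fun p q => r⁻¹ * K₁ p q) (fun p q => r⁻¹ * K₂ p q) μ μ' ν y = Pi3L ξ τ K₁ K₂ μ μ' ν y := by
  simp only [Pi3L, nonloc3_rescale ξ K₁ K₂ hr]

end Rescale

/-! ## §2 The `η`-lattice propagator `G^η_{j₀}(0)` on `ηℤ³`, `η = L^{−k}`, `k ≥ j₀`, and its lattice equation -/

section EtaPropagator

variable (ℓ j₀ k : ℕ) (a m2 : ℝ)

/-- the rescaling ratio `L^{j₀}η = L^{−(k−j₀)} = η/ξ` between the `η = L^{−k}`-lattice and the `ξ = L^{−j₀}`-lattice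
(`xiOf ℓ k / xiOf ℓ j₀`; `≤ 1` for `j₀ ≤ k`). [cite: Balaban1983Higgs3, (3.29) p.441] -/
def scale330 (ℓ j₀ k : ℕ) : ℝ := xiOf ℓ k / xiOf ℓ j₀

/-- **G^η_{j₀}(0; i, i′)** — the zero-field propagator of the `j₀`-th step read ON THE FINER LATTICE `ηℤ³`, `η = L^{−k}`, `k ≥ j₀`
(kernel w.r.t. `Σ η³`; blocks of `P_{j₀}` of side `L^{j₀}η`, i.e. `L^{j₀}` sites): the rescaling `(L^{j₀}η)^{−d+2}·G^ξ_{j₀}(0)` of gen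
9's `GxiL ℓ j₀ a m²` (`d = 3`; the mass/averaging parameters `(m², a)` are those of the `ξ`-lattice operator, so on `ηℤ³` the
operator is `−Δ^η + m²(L^{j₀}η)^{−2} + a_{j₀}(L^{j₀}η)^{−2}P_{j₀}`, `green_GetaL`). [cite: Balaban1983Higgs3, (3.26) p.440] -/
def GetaL (ℓ j₀ k : ℕ) (a m2 : ℝ) (i i' : ZSite 3) : ℝ := (scale330 ℓ j₀ k)⁻¹ * GxiL ℓ j₀ a m2 i i'

/-- kernel: `L^{j₀}η > 0`. [cite: Balaban1983Higgs3, (3.29) p.441] -/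
theorem scale330_pos : 0 < scale330 ℓ j₀ k := div_pos (xiOf_pos ℓ k) (xiOf_pos ℓ j₀)

/-- kernel: `η = (L^{j₀}η)·ξ`. [cite: Balaban1983Higgs3, (3.29) p.441] -/
theorem xiOf_eq_scale_mul : xiOf ℓ k = scale330 ℓ j₀ k * xiOf ℓ j₀ := by
  rw [scale330, div_mul_cancel₀ _ (xiOf_pos ℓ j₀).ne']

/-- kernel: `L^{j₀}η = L^{−(k−j₀)}` for `j₀ ≤ k` (`L = ℓ + 1`). [cite: Balaban1983Higgs3, (3.29) p.441] -/
theorem scale330_eq (h : j₀ ≤ k) : scale330 ℓ j₀ k = ((((ℓ : ℝ) + 1) ^ (k - j₀)))⁻¹ := by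
  have hL : ((ℓ : ℝ) + 1) ≠ 0 := by positivity
  have hk : k = (k - j₀) + j₀ := (Nat.sub_add_cancel h).symm
  rw [scale330, xiOf, xiOf]
  conv_lhs => rw [hk, pow_add]
  field_simp

/-- kernel: `L^{j₀}η ≤ 1` for `j₀ ≤ k`. [cite: Balaban1983Higgs3, (3.29) p.441] -/
theorem scale330_le_one (h : j₀ ≤ k) : scale330 ℓ j₀ k ≤ 1 := by
  rw [scale330_eq ℓ j₀ k h]
  exact inv_le_one_of_one_le₀ (one_le_pow₀ (by have : (0:ℝ) ≤ ℓ := Nat.cast_nonneg _; linarith))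

/-- kernel: the `η`-lattice propagator as a rescaled kernel, in the form used by the §1 lemmas. [cite: Balaban1983Higgs3, (3.26) p.440] -/
theorem GetaL_eq : GetaL ℓ j₀ k a m2 = fun p q => (scale330 ℓ j₀ k)⁻¹ * GxiL ℓ j₀ a m2 p q := rfl

/-- kernel: `−Δ^{rξ} = r^{−2}(−Δ^ξ)` on `ℤ³` (the spacing enters `negLapZ` only through the prefactor). [cite: Balaban1983Higgs3, (3.16) p.437] -/
theorem negLapZ_rescale (r ξ : ℝ) (f : ZSite 3 → ℝ) (z : ZSite 3) :
    negLapZ (r * ξ) f z = r⁻¹ ^ 2 * negLapZ ξ f z := by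
  simp only [negLapZ, Finset.mul_sum, mul_inv, mul_pow]
  exact Finset.sum_congr rfl fun μ _ => by ring

/-- kernel: `−Δ` is homogeneous. [cite: Balaban1983Higgs3, (3.16) p.437] -/
theorem negLapZ_const_mul (ξ s : ℝ) (f : ZSite 3 → ℝ) (z : ZSite 3) :
    negLapZ ξ (fun w => s * f w) z = s * negLapZ ξ f z := by
  simp only [negLapZ, Finset.mul_sum]
  exact Finset.sum_congr rfl fun μ _ => by ring

/-- kernel: the block mean is homogeneous. [cite: Balaban1983Higgs3, (3.16) p.437] -/
theorem blockAvg_const_mul (s : ℝ) (f : ZSite 3 → ℝ) (z : ZSite 3) :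
    blockAvg ℓ j₀ (fun w => s * f w) z = s * blockAvg ℓ j₀ f z := by
  simp only [blockAvg, Finset.mul_sum]
  exact Finset.sum_congr rfl fun w _ => by ring

/-- **THE LATTICE EQUATION OF `G^η_{j₀}(0)` ON `ηℤ³`** — the operator of (1.25)/(2.6) read on the `η`-lattice, `η = L^{−k}`,
`1 ≤ j₀ ≤ k`: `(−Δ^η G^η(y,·))(x) + m²(L^{j₀}η)^{−2}G^η(y,x) + a_{j₀}(L^{j₀}η)^{−2}(P_{j₀}G^η(y,·))(x) = δ^η_y(x) = η^{−3}·1_{x=y}`,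
`P_{j₀}` the mean over the blocks of side `L^{j₀}η` (gen 9's `green_GxiL` rescaled by `−Δ^{rξ} = r^{−2}(−Δ^ξ)`, `r = L^{j₀}η`).
[cite: Balaban1983Higgs3, (2.6) p.424] -/
theorem green_GetaL (hℓ : 1 ≤ ℓ) (hj : 1 ≤ j₀) (ha : 0 < a) (hm : 0 ≤ m2) (y x : ZSite 3) :
    negLapZ (xiOf ℓ k) (GetaL ℓ j₀ k a m2 y) x + m2 * (scale330 ℓ j₀ k)⁻¹ ^ 2 * GetaL ℓ j₀ k a m2 y x +
        B1.aSeq a ((ℓ : ℝ) + 1) j₀ * (scale330 ℓ j₀ k)⁻¹ ^ 2 * blockAvg ℓ j₀ (GetaL ℓ j₀ k a m2 y) x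
      = if x = y then (xiOf ℓ k)⁻¹ ^ 3 else 0 := by
  set r := scale330 ℓ j₀ k with hrdef
  have hr : r ≠ 0 := (scale330_pos ℓ j₀ k).ne'
  have hξ : xiOf ℓ j₀ ≠ 0 := (xiOf_pos ℓ j₀).ne'
  have hG := green_GxiL (k := j₀) (a := a) (m2 := m2) hℓ hj ha hm y x
  have e0 : GetaL ℓ j₀ k a m2 y = fun w => r⁻¹ * GxiL ℓ j₀ a m2 y w := rfl
  rw [xiOf_eq_scale_mul ℓ j₀ k, e0, negLapZ_rescale r (xiOf ℓ j₀), negLapZ_const_mul, blockAvg_const_mul]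
  have e1 : (if x = y then (r * xiOf ℓ j₀)⁻¹ ^ 3 else (0:ℝ)) = r⁻¹ ^ 3 * (if x = y then (xiOf ℓ j₀)⁻¹ ^ 3 else 0) := by
    split_ifs
    · rw [mul_inv, mul_pow]
    · rw [mul_zero]
  rw [e1, ← hG]
  ring

/-- `G^η_{j₀}(0)` is symmetric. [cite: Balaban1983Higgs3, (3.26) p.440] -/
theorem GetaL_comm (y y' : ZSite 3) : GetaL ℓ j₀ k a m2 y y' = GetaL ℓ j₀ k a m2 y' y := by
  rw [GetaL, GetaL, GxiL_comm]

end EtaPropagator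

/-! ## §3 The p. 441 display at the instance: `Π^{(η,j₀)} = (L^{j₀}η)^{−d+2}Π^{(ξ,j₀)}`, `Π^{(η,j₀)}_{··ν} = (L^{j₀}η)^{−d+3}Π^{(ξ,j₀)}_{··ν}` -/

section Display441

variable (ℓ j₀ k : ℕ) (a m2 τ : ℝ)

/-- **p. 441, first display, ON THE INFINITE LATTICE**: `Π^{(η,j₀)}_{μμ′}(x) = (L^{j₀}η)^{−d+2}Π^{(L^{−j₀},j₀)}_{μμ′}(y)`, `d = 3`,
`y = (L^{j₀}η)^{−1}x` (same integer label), for the kernel of (3.26) with `G^η_{j₀}(0)` (`GetaL`) resp. `G^ξ_{j₀}(0)` (`GxiL`) in all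
three slots. [cite: Balaban1983Higgs3, (3.29) p.441] -/
theorem Pi2L_eta_eq (μ μ' : Fin 3) (i : ZSite 3) :
    Pi2L (xiOf ℓ k) τ (GetaL ℓ j₀ k a m2) (GetaL ℓ j₀ k a m2) (GetaL ℓ j₀ k a m2) μ μ' i =
      (scale330 ℓ j₀ k)⁻¹ * Pi2L (xiOf ℓ j₀) τ (GxiL ℓ j₀ a m2) (GxiL ℓ j₀ a m2) (GxiL ℓ j₀ a m2) μ μ' i := by
  rw [xiOf_eq_scale_mul ℓ j₀ k, GetaL_eq]
  exact Pi2L_rescale (xiOf ℓ j₀) _ _ _ (scale330_pos ℓ j₀ k).ne' τ μ μ' i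

/-- **p. 441, second display, ON THE INFINITE LATTICE**: `Π^{(η,j₀)}_{μμ′ν}(x) = (L^{j₀}η)^{−d+3}Π^{(L^{−j₀},j₀)}_{μμ′ν}(y)` with
`−d + 3 = 0`. [cite: Balaban1983Higgs3, (3.29) p.441] -/
theorem Pi3L_eta_eq (μ μ' ν : Fin 3) (i : ZSite 3) :
    Pi3L (xiOf ℓ k) τ (GetaL ℓ j₀ k a m2) (GetaL ℓ j₀ k a m2) μ μ' ν i =
      Pi3L (xiOf ℓ j₀) τ (GxiL ℓ j₀ a m2) (GxiL ℓ j₀ a m2) μ μ' ν i := by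
  rw [xiOf_eq_scale_mul ℓ j₀ k, GetaL_eq]
  exact Pi3L_rescale (xiOf ℓ j₀) _ _ (scale330_pos ℓ j₀ k).ne' τ μ μ' ν i

end Display441

/-! ## §4 The sentence after (3.30) on the infinite `η`-lattice -/

section Sentence330

/-- **"the coefficient at the vertex [Π_{μμ′}] is proportional to (L^{j₀}η)^{−d+2}"** ON THE INFINITE η-LATTICE (zero field,
`d = 3`): there is `Cst` (from `L` and the window) with `|Π^{(η,j₀)}_{μμ′}[G^η_{j₀}(0)](i)| ≤ Cst·(L^{j₀}η)^{−1}·|tr q²|` for every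
`1 ≤ j₀ ≤ k`, `a₋ ≤ a ≤ a₊`, `0 ≤ m² ≤ m²₊`, `μ, μ′, i` — the factor multiplying `(L^{j₀}η)^{−1}` is bounded uniformly in the
spacings (gen 9's `exists_Pi2L_GxiL_bound` transported by `Pi2L_eta_eq`). [cite: Balaban1983Higgs3, (3.30) p.442] -/
theorem abs_Pi2L_eta_le {ℓ : ℕ} (hℓ : 1 ≤ ℓ) (amin aplus m2plus : ℝ) (ha : 0 < amin) :
    ∃ Cst : ℝ, 0 < Cst ∧ ∀ (j₀ k : ℕ), 1 ≤ j₀ → j₀ ≤ k → ∀ (a m2 : ℝ), amin ≤ a → a ≤ aplus → 0 ≤ m2 → m2 ≤ m2plus →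
      ∀ (τ : ℝ) (μ μ' : Fin 3) (i : ZSite 3),
        |Pi2L (xiOf ℓ k) τ (GetaL ℓ j₀ k a m2) (GetaL ℓ j₀ k a m2) (GetaL ℓ j₀ k a m2) μ μ' i| ≤
          Cst * (scale330 ℓ j₀ k)⁻¹ * |τ| := by
  obtain ⟨Cst, hCst, hB⟩ := exists_Pi2L_GxiL_bound hℓ amin aplus m2plus ha
  refine ⟨Cst, hCst, fun j₀ k hj _ a m2 ha1 ha2 hm1 hm2 τ μ μ' i => ?_⟩
  have hr := scale330_pos ℓ j₀ k
  rw [Pi2L_eta_eq, abs_mul, abs_of_pos (inv_pos.2 hr)]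
  calc (scale330 ℓ j₀ k)⁻¹ * |Pi2L (xiOf ℓ j₀) τ (GxiL ℓ j₀ a m2) (GxiL ℓ j₀ a m2) (GxiL ℓ j₀ a m2) μ μ' i|
      ≤ (scale330 ℓ j₀ k)⁻¹ * (Cst * |τ|) :=
        mul_le_mul_of_nonneg_left (hB j₀ hj a m2 ha1 ha2 hm1 hm2 τ μ μ' i) (inv_pos.2 hr).le
    _ = Cst * (scale330 ℓ j₀ k)⁻¹ * |τ| := by ring

/-- **"proportional to (L^{j₀}η)^{−d+2}"**, exact form: `Π^{(η,j₀)}_{μμ′}(i) = (L^{j₀}η)^{−1}·B` with `|B| ≤ Cst·|tr q²|` uniformly.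
[cite: Balaban1983Higgs3, (3.30) p.442] -/
theorem Pi2L_eta_eq_bounded {ℓ : ℕ} (hℓ : 1 ≤ ℓ) (amin aplus m2plus : ℝ) (ha : 0 < amin) :
    ∃ Cst : ℝ, 0 < Cst ∧ ∀ (j₀ k : ℕ), 1 ≤ j₀ → j₀ ≤ k → ∀ (a m2 : ℝ), amin ≤ a → a ≤ aplus → 0 ≤ m2 → m2 ≤ m2plus →
      ∀ (τ : ℝ) (μ μ' : Fin 3) (i : ZSite 3), ∃ B : ℝ, |B| ≤ Cst * |τ| ∧
        Pi2L (xiOf ℓ k) τ (GetaL ℓ j₀ k a m2) (GetaL ℓ j₀ k a m2) (GetaL ℓ j₀ k a m2) μ μ' i = (scale330 ℓ j₀ k)⁻¹ * B := by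
  obtain ⟨Cst, hCst, hB⟩ := exists_Pi2L_GxiL_bound hℓ amin aplus m2plus ha
  refine ⟨Cst, hCst, fun j₀ k hj _ a m2 ha1 ha2 hm1 hm2 τ μ μ' i => ⟨_, hB j₀ hj a m2 ha1 ha2 hm1 hm2 τ μ μ' i, ?_⟩⟩
  exact Pi2L_eta_eq ℓ j₀ k a m2 τ μ μ' i

/-- **"the coefficient at the vertex [Π_{μμ′ν}] is bounded"** ON THE INFINITE η-LATTICE (zero field, `d = 3`): `|Π^{(η,j₀)}_{μμ′ν}(i)|
≤ Cst·|tr q²|` for every `1 ≤ j₀ ≤ k`, the window, `μ, μ′, ν, i` (gen 9's `exists_Pi3L_GxiL_bound` transported by `Pi3L_eta_eq`).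
[cite: Balaban1983Higgs3, (3.30) p.442] -/
theorem abs_Pi3L_eta_le {ℓ : ℕ} (hℓ : 1 ≤ ℓ) (amin aplus m2plus : ℝ) (ha : 0 < amin) :
    ∃ Cst : ℝ, 0 < Cst ∧ ∀ (j₀ k : ℕ), 1 ≤ j₀ → j₀ ≤ k → ∀ (a m2 : ℝ), amin ≤ a → a ≤ aplus → 0 ≤ m2 → m2 ≤ m2plus →
      ∀ (τ : ℝ) (μ μ' ν : Fin 3) (i : ZSite 3),
        |Pi3L (xiOf ℓ k) τ (GetaL ℓ j₀ k a m2) (GetaL ℓ j₀ k a m2) μ μ' ν i| ≤ Cst * |τ| := by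
  obtain ⟨Cst, hCst, hB⟩ := exists_Pi3L_GxiL_bound hℓ amin aplus m2plus ha
  refine ⟨Cst, hCst, fun j₀ k hj _ a m2 ha1 ha2 hm1 hm2 τ μ μ' ν i => ?_⟩
  rw [Pi3L_eta_eq]
  exact hB j₀ hj a m2 ha1 ha2 hm1 hm2 τ μ μ' ν i

/-- **THE SENTENCE AFTER (3.30), INFINITE-VOLUME READING, ASSEMBLED** — p. 442: *"where the coefficient at the vertex [Π_{μμ′ν}] is
bounded, and the coefficient at the vertex [Π_{μμ′}] is proportional to (L^{j₀}η)^{−d+2}, and j₀ is the lowest j-index of the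
external legs"*: ONE constant for all scales `1 ≤ j₀ ≤ k` and the whole window, for the `η`-lattice propagator `G^η_{j₀}(0)` on `ηℤ³`
(zero field, `d = 3`). [cite: Balaban1983Higgs3, (3.30) p.442] -/
theorem eq330_coefficients_zero_lattice {ℓ : ℕ} (hℓ : 1 ≤ ℓ) (amin aplus m2plus : ℝ) (ha : 0 < amin) :
    ∃ Cst : ℝ, 0 < Cst ∧ ∀ (j₀ k : ℕ), 1 ≤ j₀ → j₀ ≤ k → ∀ (a m2 : ℝ), amin ≤ a → a ≤ aplus → 0 ≤ m2 → m2 ≤ m2plus →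
      ∀ (τ : ℝ) (μ μ' ν : Fin 3) (i : ZSite 3),
        |Pi3L (xiOf ℓ k) τ (GetaL ℓ j₀ k a m2) (GetaL ℓ j₀ k a m2) μ μ' ν i| ≤ Cst * |τ| ∧
        |Pi2L (xiOf ℓ k) τ (GetaL ℓ j₀ k a m2) (GetaL ℓ j₀ k a m2) (GetaL ℓ j₀ k a m2) μ μ' i| ≤
          Cst * (scale330 ℓ j₀ k)⁻¹ * |τ| := by
  obtain ⟨C₂, hC₂, h₂⟩ := abs_Pi2L_eta_le hℓ amin aplus m2plus ha
  obtain ⟨C₃, hC₃, h₃⟩ := abs_Pi3L_eta_le hℓ amin aplus m2plus ha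
  refine ⟨max C₂ C₃, lt_max_of_lt_left hC₂, fun j₀ k hj hjk a m2 ha1 ha2 hm1 hm2 τ μ μ' ν i => ⟨?_, ?_⟩⟩
  · exact (h₃ j₀ k hj hjk a m2 ha1 ha2 hm1 hm2 τ μ μ' ν i).trans
      (mul_le_mul_of_nonneg_right (le_max_right _ _) (abs_nonneg _))
  · have hr := (inv_pos.2 (scale330_pos ℓ j₀ k)).le
    exact (h₂ j₀ k hj hjk a m2 ha1 ha2 hm1 hm2 τ μ μ' i).trans
      (mul_le_mul_of_nonneg_right (mul_le_mul_of_nonneg_right (le_max_left _ _) hr) (abs_nonneg _))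

end Sentence330

end

end Literature.MathematicalPhysics.QuantumFieldTheory.Balaban1983to89.B3Eq330EtaZeroLattice
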